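import Summits.QuantumFields.BalabanUV.Beta.EriceFlowEnclosureB12AsPrintedPointwiseFadingOrder

/-!
# Beta / EriceFlowEnclosureB12AsPrintedPointwiseFadingSign — WHAT (0.31) FORCES POINTWISE, part 8: WHAT THE TYPED THEOREM 2 FORCES ON THE BOXES UNDER FADING MEMORY —
# THE SIGN UP TO O(δ).  Parts 5–6 (`…PointwiseCover`, `…PointwiseFading`, gen 43) derived the AF letter on the boxes from the g-UNIFORM reading of (0.31); part 7
# (`…PointwiseFadingOrder`, gen 44) made the local uniqueness they consume FREE under node U2's coupling-chart moduli `HistLipschitz Λ γ_U S.β` ∕ `FadingMemory C θ Λ`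
# (0 ≤ θ < 1).  Here the two are combined IN THE TYPED READING (`Theorem2Statement`: «there exist constants β, β′» AFTER «for a sufficiently small positive g», as the tree
# types p. 259): part 5's coverage holds with per-endpoint constants B₁(g) > 0 only, so along every tuned run history β_{k+1} ≥ 0, and the oscillation letter of the moduli
# (Λ = C∕(1−θ), part 6 `histOsc_of_fadingMemory`) spreads THAT over the box: **`negPart_of_theorem2_fadingMemory`** — `Theorem2Statement S hL` + `Definitions` + `hrg` + (U) + the
# moduli ⟹ ∃ x₁ > 0 ∀ δ ∈ ]0, x₁]: `BetaLowerH (−(C∕(1−θ))·δ) δ S.β ∧ BetaUpperH (M + (C∕(1−θ))·δ) δ S.β` — the NEGATIVE PART of β_{k+1} on ]0, δ]^{k+1} is at most (C∕(1−θ))·δ, at every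
# scale, with NO uniqueness ∕ Markov ∕ injectivity ∕ sign letter and NO uniform reading.  Whether the typed Theorem 2 forces the sign letter `FlowStep.BetaSignH` itself under the
# moduli is answered NO by the companion `…PointwiseFadingSignWitness` (a two-coupling ramp inside the moduli with Theorem 2 as typed and β_2 < 0 inside every box); in the Markov
# reading it DOES (part 1 #59a `betaSignH_of_theorem2_markov`, Λ = 0)
# (β-flow team, prover 2 = lower ∕ positivity side, unit `b2b-balaban-beta-bflow-p2`, gen 44; ROW AP-I × node U2's letters)

HONEST FRAMING (page 1 of everything the β sub-cell writes): discharging `BetaPertH` makes Bałaban's UV stability UNCONDITIONAL — a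
real constructive-QFT result; it is NOT the continuum limit and NOT the Clay problem.  HONEST DEPENDENCY (cell reorg 2026-08-19,
verbatim): «continuum YM on T⁴ ⇐ BetaPertH ∧ nine spine estimates (0/9 proved); BetaPertH ⇐ (D1) ∧ (D4) ∧ CAP+tail; G-an2-4 gates
asym, D1 and NE2/3/4.»  THIS MODULE DISCHARGES NOTHING: bookkeeping from the NAMED FIELDS of the statement-exact typing `B12BetaAsPrinted` of [I] = T. Bałaban, Commun.
Math. Phys. **109** (1987) [Balaban1987RG1] (`Definitions`; `Theorem2Statement` — STATED WITHOUT PROOF, p. 259, [Balaban1989LargeFieldII] p. 355 — as a HYPOTHESIS) and node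
U2's HYPOTHESIS SHAPES `T4CouplingMatching.HistLipschitz` ∕ `FadingMemory` (NOT printed; p. 298 states the history dependence only; GAPS G-t4-U2-2), plus prover 1's binder
`hrg` (or the upper letter (U), p. 264 «uniformly bounded», with b′γ_U² < 1).  Nothing of Bałaban's (1.22) is asserted.

WHAT THIS FILE PROVES (0 sorry, 0 def): **`negPart_of_theorem2_fadingMemory`** (binder form), **`negPart_of_theorem2_fadingMemory'`** (`hrg` discharged from (U) + `StandingHypotheses`),
`betaLowerH_neg_of_theorem2_fadingMemory` (the lower half alone: ∀ small δ, β_{k+1} ≥ −(C∕(1−θ))δ on ]0, δ]^{k+1}).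
NOT CLAIMED: the sign letter; any modulus, sign or bound for Bałaban's β; which reading print intends; Theorem 2; `BetaPertH`; continuum; Clay.
-/

namespace Summit.QuantumFields.BalabanUV.Beta.EriceFlowEnclosureB12AsPrintedPointwiseFadingSign

open Literature.MathematicalPhysics.QuantumFieldTheory.Balaban1983to89
open Literature.MathematicalPhysics.QuantumFieldTheory.Balaban1983to89.B12BetaAsPrinted
open Literature.MathematicalPhysics.QuantumFieldTheory.Balaban1983to89.FlowStep (HBeta prefixOf Box mem_box box_mono RGEqH BetaUpperH BetaLowerH)
open Literature.MathematicalPhysics.QuantumFieldTheory.Balaban1983to89.T4CouplingMatching (HistLipschitz FadingMemory)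
open Summit.QuantumFields.BalabanUV.Beta.EriceFlowEnclosureB12AsPrintedTunedUpper (hrg_of_betaUpperH prefixOf_mem_box_of_inInterval)
open Summit.QuantumFields.BalabanUV.Beta.EriceFlowEnclosureB12AsPrintedPointwiseCover (cover_of_theorem2Statement letters_of_cover_histOsc)
open Summit.QuantumFields.BalabanUV.Beta.EriceFlowEnclosureB12AsPrintedPointwiseFading (histOsc_of_fadingMemory)
open Summit.QuantumFields.BalabanUV.Beta.EriceFlowEnclosureB12AsPrintedPointwiseFadingOrder (localUnique_signFree)

noncomputable section

variable {S : Setting}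

/-- **THE TYPED THEOREM 2 FORCES THE SIGN UP TO O(δ) UNDER FADING MEMORY.**  `Theorem2Statement S hL` (AS TYPED: per-endpoint constants), the printed `Definitions`,
prover 1's binder `hrg` on ]0, γ_U] ((0.20) along in-interval runs), the upper letter (U) `β_{k+1} ≤ M` on ]0, γ_U]^{k+1}, and coupling-chart moduli `HistLipschitz Λ γ_U S.β`
with `FadingMemory C θ Λ` (0 ≤ θ < 1, 0 ≤ C) ⟹ there is x₁ > 0 such that for every δ ∈ ]0, x₁] and every scale k, on the box ]0, δ]^{k+1}:
`−(C∕(1−θ))·δ ≤ β_{k+1} ≤ M + (C∕(1−θ))·δ`.  Route: part 7's `localUnique_signFree` (uniqueness free) feeds part 5's `cover_of_theorem2Statement` (every small x is the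
k-th coupling of a tuned run of length k + 1 whose last window carries β_{k+1} ≥ B₁(g) ln L > 0 — typed constant, so only `≥ 0` survives uniformly), and part 6's
`histOsc_of_fadingMemory` spreads it over the box (`letters_of_cover_histOsc` with b = 0, b′ = M).  No uniform reading, no sign ∕ Markov ∕ injectivity letter.
[cite: Balaban1987RG1, Thm 2 (0.31) p.259 with (0.20) p.256, §1 p.264 and p.298] -/
theorem negPart_of_theorem2_fadingMemory {hL : Odd S.L ∧ 1 < S.L} (hT : Theorem2Statement S hL) (hD : Definitions S) (m : ℕ)
    {γU M θ C : ℝ} {Λ : ℕ → ℕ → ℝ} (hγU : 0 < γU) (hθ0 : 0 ≤ θ) (hθ1 : θ < 1) (hC : 0 ≤ C)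
    (hrg : ∀ P : B12.RunParams, Step.InInterval γU P.K (S.cpl P) → RGEqH P.K S.β (S.cpl P))
    (hub : BetaUpperH M γU S.β) (hHL : HistLipschitz Λ γU S.β) (hΛ : FadingMemory C θ Λ) :
    ∃ x₁ : ℝ, 0 < x₁ ∧ x₁ ≤ γU ∧ ∀ δ : ℝ, 0 < δ → δ ≤ x₁ →
      BetaLowerH (-(C / (1 - θ) * δ)) δ S.β ∧ BetaUpperH (M + C / (1 - θ) * δ) δ S.β := by
  have hlog : 0 < Real.log (S.L : ℝ) := Real.log_pos (by exact_mod_cast hL.2)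
  obtain ⟨γ₁, hγ₁, hγ₁U, hcov⟩ := cover_of_theorem2Statement hT hD m hγU hrg hub
  obtain ⟨g₂, hg₂, huniq⟩ := localUnique_signFree hD (m := m) hθ0 hθ1 hC hγU hrg hHL hΛ
  -- local uniqueness on the smaller box min(g₂, γ₁)
  have huniq' : ∀ (K : ℕ) (g₀ g₀' : ℝ), Step.InInterval (min g₂ γ₁) K (S.cpl ⟨K, m, g₀⟩) →
      Step.InInterval (min g₂ γ₁) K (S.cpl ⟨K, m, g₀'⟩) → S.cpl ⟨K, m, g₀⟩ K = S.cpl ⟨K, m, g₀'⟩ K → g₀ = g₀' :=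
    fun K g₀ g₀' hI hI' he => huniq K g₀ g₀' (fun i hi => ⟨(hI i hi).1, (hI i hi).2.trans (min_le_left _ _)⟩)
      (fun i hi => ⟨(hI' i hi).1, (hI' i hi).2.trans (min_le_left _ _)⟩) he
  obtain ⟨x₁, hx₁, hx₁g, hcv⟩ := hcov (min g₂ γ₁) (lt_min hg₂ hγ₁) (min_le_right _ _) huniq'
  have hx₁U : x₁ ≤ γU := (hx₁g.trans (min_le_right _ _)).trans hγ₁U
  refine ⟨x₁, hx₁, hx₁U, fun δ hδ hδx => ?_⟩
  have hδU : δ ≤ γU := hδx.trans hx₁U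
  -- coverage with the uniform window [0, M]
  have hcov0 : ∀ (k : ℕ) (x : ℝ), 0 < x → x ≤ x₁ → ∃ g₀ : ℝ, Step.InInterval x k (S.cpl ⟨k + 1, m, g₀⟩) ∧
      S.cpl ⟨k + 1, m, g₀⟩ k = x ∧ 0 ≤ S.β k (prefixOf (S.cpl ⟨k + 1, m, g₀⟩) k) ∧ S.β k (prefixOf (S.cpl ⟨k + 1, m, g₀⟩) k) ≤ M := by
    intro k x hx hxle
    obtain ⟨g₀, g, β, β', -, -, hβ, -, hI, hk, -, hlo, -⟩ := hcv k x hx hxle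
    refine ⟨g₀, hI, hk, le_trans (mul_pos hβ hlog).le hlo, hub k _ ?_⟩
    exact box_mono (hxle.trans hx₁U) k (prefixOf_mem_box_of_inInterval hI le_rfl)
  have h := letters_of_cover_histOsc (S := S) (b := 0) (b' := M) (Λ := C / (1 - θ))
    (fun k p q hp hq hl => histOsc_of_fadingMemory hθ0 hθ1 hC hHL hΛ hδ hδU k p q hp hq hl) hcov0 hδx
  simpa only [zero_sub] using h

/-- The same with prover 1's binder `hrg` DISCHARGED from the upper letter (U) with Mγ_U² < 1 and the standing hypotheses (`…TunedUpper.hrg_of_betaUpperH`): inputs = `StandingHypotheses`,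
`Definitions`, `Theorem2Statement` AS TYPED, (U), the moduli. [cite: Balaban1987RG1, Thm 2 (0.31) p.259 with (0.20) p.256, §1 p.264 and p.298] -/
theorem negPart_of_theorem2_fadingMemory' (hH : StandingHypotheses S) (hD : Definitions S) (hT : Theorem2Statement S (hL_of_standing hH)) (m : ℕ)
    {γU M θ C : ℝ} {Λ : ℕ → ℕ → ℝ} (hγU : 0 < γU) (hθ0 : 0 ≤ θ) (hθ1 : θ < 1) (hC : 0 ≤ C)
    (hub : BetaUpperH M γU S.β) (hsmall : M * γU ^ 2 < 1) (hHL : HistLipschitz Λ γU S.β) (hΛ : FadingMemory C θ Λ) :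
    ∃ x₁ : ℝ, 0 < x₁ ∧ x₁ ≤ γU ∧ ∀ δ : ℝ, 0 < δ → δ ≤ x₁ →
      BetaLowerH (-(C / (1 - θ) * δ)) δ S.β ∧ BetaUpperH (M + C / (1 - θ) * δ) δ S.β :=
  negPart_of_theorem2_fadingMemory hT hD m hγU hθ0 hθ1 hC (hrg_of_betaUpperH hD hγU hub hsmall) hub hHL hΛ

/-- **THE LOWER HALF ALONE**: under the hypotheses of `negPart_of_theorem2_fadingMemory`, for every small δ the β-functions are `≥ −(C∕(1−θ))·δ` on ]0, δ]^{k+1} at every scale —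
the typed Theorem 2's pointwise content on the lower side under fading memory.  (The sign letter `BetaSignH` itself is NOT forced: companion `…PointwiseFadingSignWitness`.)
[cite: Balaban1987RG1, Thm 2 (0.31) p.259 with (0.20) p.256 and p.298] -/
theorem betaLowerH_neg_of_theorem2_fadingMemory {hL : Odd S.L ∧ 1 < S.L} (hT : Theorem2Statement S hL) (hD : Definitions S) (m : ℕ)
    {γU M θ C : ℝ} {Λ : ℕ → ℕ → ℝ} (hγU : 0 < γU) (hθ0 : 0 ≤ θ) (hθ1 : θ < 1) (hC : 0 ≤ C)
    (hrg : ∀ P : B12.RunParams, Step.InInterval γU P.K (S.cpl P) → RGEqH P.K S.β (S.cpl P))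
    (hub : BetaUpperH M γU S.β) (hHL : HistLipschitz Λ γU S.β) (hΛ : FadingMemory C θ Λ) :
    ∃ x₁ : ℝ, 0 < x₁ ∧ ∀ δ : ℝ, 0 < δ → δ ≤ x₁ → ∀ (k : ℕ) (p : Fin (k + 1) → ℝ), p ∈ Box δ k → -(C / (1 - θ) * δ) ≤ S.β k p := by
  obtain ⟨x₁, hx₁, -, h⟩ := negPart_of_theorem2_fadingMemory hT hD m hγU hθ0 hθ1 hC hrg hub hHL hΛ
  exact ⟨x₁, hx₁, fun δ hδ hδx k p hp => (h δ hδ hδx).1 k p hp⟩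

end

end Summit.QuantumFields.BalabanUV.Beta.EriceFlowEnclosureB12AsPrintedPointwiseFadingSign
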